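import Summits.Parity.GeneralizedHardyLittlewood.Theses.LeeYangFibres
import Summits.Parity.GeneralizedHardyLittlewood.Theorems.LeeYangFibresPrimeCellsRelativeLocator
import Summits.Parity.GeneralizedHardyLittlewood.Theorems.LeeYangFibresPrimeCellsRelativeDicksonTools
import Literature.NumberTheory.Sieve.LinearEquationsInPrimesLocalObstruction
import Literature.NumberTheory.Sieve.LinearEquationsInPrimesDimOne
import Literature.NumberTheory.Sieve.ParityWave0DicksonProofs
import HarnessLib

/-!
# `PrimeCellsRelative` implies Dickson's conjecture (crux stmt-Parity-14112, line `Sketch`)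

Hardness certificate for the crux `PrimeCellsRelative` of route `LeeYangFibres`
(Parity / GeneralizedHardyLittlewood): the crux implies the tree's registered open conjecture
`Literature.NumberTheory.Sieve.DicksonConjecture` (parity.S07, Dickson 1904: every admissible finite
system of forms `aᵢ n + bᵢ`, `aᵢ ≥ 1`, is simultaneously prime for infinitely many `n`), hence so
do `RelativeDimOne` (stmt-Parity-14113), `DimOne` (stmt-Parity-0819) and the summit conjunct
`GeneralizedHardyLittlewood`; and through the tree's consequences of Dickson's conjecture the crux
refutes the second Hardy–Littlewood conjecture (Hensley–Richards) and gives `DHL[k, k]` for all `k`.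

Proof. Deduplicate the forms; admissibility makes distinct forms pairwise non-proportional
(`exists_prime_dvd_forall_of_proportional`, file `…DicksonTools`), so the deduplicated system `Ψ` is non-degenerate in
Green–Tao's sense, and it has no local obstruction, so `𝔖(Ψ) > 0`
(`Literature.NumberTheory.Sieve.singularProduct_pos_of_localFactor_pos`). Apply the crux with
`K = [0, N]` (`β_∞ ≥ N`) and `ε = min(1/2, 𝔖/2^{t+2})`: by the prime number theorem window
(`Theorems.LeeYangFibresCells.eventually_primeCounting_window`) the main term is
`≥ 𝔖 N/(2 log N)^t`, so the cell `{0 ≤ n ≤ N : every aᵢ n + bᵢ a prime > N^{1/u}}` is non-empty for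
all large `N` (`cell_pos_arith`), and its points have `a₀ n + b₀ > N^{1/u}`, whence `n → ∞`.

References: L. E. Dickson, Messenger of Math. 33 (1904) 155–161 [Dickson1904]; B. Green, T. Tao,
Ann. of Math. 171 (2010), Conj. 1.2 / 1.4 and Lemma 1.3 [GreenTao2010]; D. Hensley, I. Richards,
Acta Arith. 25 (1974) 375–391 [HensleyRichards1974]; D. H. J. Polymath, Res. Math. Sci. 1 (2014),
Claim 3.1 [Polymath8b2014].
-/

noncomputable section

namespace Summit.Parity.GeneralizedHardyLittlewood.Cruxes.PrimeCellsRelative.Sketch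

open scoped BigOperators Topology Classical
open Filter Finset MeasureTheory Literature.NumberTheory.Sieve
open Summit.Parity.GeneralizedHardyLittlewood.Theses.LeeYangFibres
open Summit.Parity.GeneralizedHardyLittlewood.Theorems.LeeYangFibresCells

/-! ### The system `(aᵢ n + bᵢ)ᵢ` as Green–Tao data -/

variable {t : ℕ}

/-- `ψᵢ(n) = aᵢ n₀ + bᵢ` for the system `Ψ = (aᵢ n + bᵢ)ᵢ`. [folklore] -/
theorem dickson_eval (a b : Fin t → ℕ) (i : Fin t) (n : Fin 1 → ℤ) :
    ((fun i => (⟨fun _ => (a i : ℤ), (b i : ℤ)⟩ : AffLinForm 1)) i).eval n = (a i : ℤ) * n 0 + b i := by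
  rw [DimOne.eval_eq]

/-- **Non-degeneracy from admissibility.** An injective admissible family `(aᵢ n + bᵢ)ᵢ` with `aᵢ ≥ 1`
is a non-degenerate system in Green–Tao's sense: the linear parts are non-zero, and two distinct
proportional forms would have a fixed prime divisor (`exists_prime_dvd_forall_of_proportional`),
contradicting admissibility. [cite: GreenTao2010, Def. 1.1] -/
theorem isNondegenerateSystem_dickson (a b : Fin t → ℕ) (ha : ∀ i, 1 ≤ a i)
    (hinj : Function.Injective fun i => (a i, b i))
    (hadm : ∀ p : ℕ, p.Prime → ∃ n : ℕ, ¬p ∣ ∏ i, (a i * n + b i)) :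
    IsNondegenerateSystem (fun i => (⟨fun _ => (a i : ℤ), (b i : ℤ)⟩ : AffLinForm 1)) := by
  refine ⟨fun i h0 => ?_, fun i j hij A B hAB => ?_⟩
  · have := congr_fun h0 0
    simp only [Pi.zero_apply, Nat.cast_eq_zero] at this
    have := ha i
    omega
  · -- evaluate the proportionality at `n = 0` and `n = 1`
    have e0 := hAB (fun _ => 0)
    have e1 := hAB (fun _ => 1)
    simp only [dickson_eval, mul_zero, zero_add, mul_one] at e0 e1
    have h1 : A * (a i : ℤ) = B * (a j : ℤ) := by linear_combination e1 - e0
    have h2 : A * (b i : ℤ) = B * (b j : ℤ) := e0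
    have hai0 : (0 : ℤ) < a i := by exact_mod_cast ha i
    have haj0 : (0 : ℤ) < a j := by exact_mod_cast ha j
    by_cases hA : A = 0
    · refine ⟨hA, ?_⟩
      rw [hA, zero_mul] at h1
      rcases mul_eq_zero.mp h1.symm with h | h
      · exact h
      · exact absurd h haj0.ne'
    by_cases hB : B = 0
    · rw [hB, zero_mul] at h1
      rcases mul_eq_zero.mp h1 with h | h
      · exact absurd h hA
      · exact absurd h hai0.ne'
    exfalso
    have hne : (a i, b i) ≠ (a j, b j) := fun h => hij (hinj h)
    -- a fixed prime divisor of one of the forms contradicts admissibility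
    have fixed : ∀ l : Fin t, ∀ p : ℕ, p.Prime → (∀ n : ℕ, p ∣ a l * n + b l) → False := by
      intro l p hp hl
      obtain ⟨n, hn⟩ := hadm p hp
      exact hn ((hl n).trans (Finset.dvd_prod_of_mem (fun i => a i * n + b i) (Finset.mem_univ l)))
    obtain ⟨p, hp, hcase⟩ := exists_prime_dvd_forall_of_proportional hA hB (ha i) (ha j) hne h1 h2
    rcases hcase with h | h
    · exact fixed j p hp h
    · exact fixed i p hp h

/-- **No local obstruction from admissibility**: `𝔖(Ψ) > 0` for an injective admissible family
(`aᵢ ≥ 1`): a witness `n` with `p ∤ ∏ᵢ (aᵢ n + bᵢ)` is a good residue mod `p`, so `β_p > 0` for every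
prime `p` (`goodCount_pos_iff_localFactor_pos`), and `singularProduct_pos_of_localFactor_pos` applies.
[cite: GreenTao2010, Lemma 1.3 and the sentence following it] -/
theorem singularProduct_dickson_pos (a b : Fin t → ℕ) (ha : ∀ i, 1 ≤ a i)
    (hinj : Function.Injective fun i => (a i, b i))
    (hadm : ∀ p : ℕ, p.Prime → ∃ n : ℕ, ¬p ∣ ∏ i, (a i * n + b i)) :
    0 < singularProduct (fun i => (⟨fun _ => (a i : ℤ), (b i : ℤ)⟩ : AffLinForm 1)) := by
  set Ψ : Fin t → AffLinForm 1 := fun i => ⟨fun _ => (a i : ℤ), (b i : ℤ)⟩ with hΨ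
  refine singularProduct_pos_of_localFactor_pos Ψ (isNondegenerateSystem_dickson a b ha hinj hadm)
    fun p hp => ?_
  haveI := Fact.mk hp
  refine (goodCount_pos_iff_localFactor_pos Ψ hp).mp ?_
  obtain ⟨n, hn⟩ := hadm p hp
  refine Finset.card_pos.mpr ⟨fun _ => (n : ZMod p), ?_⟩
  rw [Finset.mem_filter]
  refine ⟨Finset.mem_univ _, fun i h0 => hn ?_⟩
  refine Dvd.dvd.trans ?_ (Finset.dvd_prod_of_mem (fun i => a i * n + b i) (Finset.mem_univ i))
  rw [← ZMod.natCast_eq_zero_iff, ← h0]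
  simp only [hΨ, AffLinForm.modEval, Finset.univ_unique, Finset.sum_singleton]
  push_cast
  ring

/-- `‖Ψ‖_N ≤ ∑ᵢ (aᵢ + bᵢ)` for `N ≥ 1`. [cite: GreenTao2010, (1.1)] -/
theorem affLinSize_dickson_le (a b : Fin t → ℕ) {N : ℕ} (hN : 1 ≤ N) :
    affLinSize (fun i => (⟨fun _ => (a i : ℤ), (b i : ℤ)⟩ : AffLinForm 1)) N ≤
      ((∑ i, (a i + b i) : ℕ) : ℝ) := by
  unfold affLinSize
  have hN1 : (1 : ℝ) ≤ N := by exact_mod_cast hN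
  push_cast
  rw [Finset.sum_add_distrib]
  gcongr with i _ i _
  · simp
  · rw [abs_div, Nat.abs_cast, Nat.abs_cast]
    exact div_le_self (Nat.cast_nonneg _) hN1

/-- `β_∞(Ψ, [0, N]) ≥ N`: the slice `{0 ≤ r ≤ N : aᵢ r + bᵢ > 0 ∀ i}` contains `(0, N]`.
[cite: GreenTao2010, (1.4)] -/
theorem le_archFactor_dickson (a b : Fin t → ℕ) (ha : ∀ i, 1 ≤ a i) (N : ℕ) :
    (N : ℝ) ≤ archFactor (fun i => (⟨fun _ => (a i : ℤ), (b i : ℤ)⟩ : AffLinForm 1))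
      (Set.Icc (fun _ : Fin 1 => (0 : ℝ)) (fun _ => (N : ℝ))) := by
  rw [DimOne.archFactor_eq]
  set S := {r : ℝ | (fun _ : Fin 1 => r) ∈ Set.Icc (fun _ : Fin 1 => (0 : ℝ)) (fun _ => (N : ℝ)) ∧
    ∀ i, 0 < ((fun i => (⟨fun _ => (a i : ℤ), (b i : ℤ)⟩ : AffLinForm 1)) i).realEval fun _ => r}
    with hS
  have hsub : Set.Ioc (0 : ℝ) N ⊆ S := by
    intro r hr
    rw [Set.mem_Ioc] at hr
    refine ⟨⟨fun _ => hr.1.le, fun _ => hr.2⟩, fun i => ?_⟩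
    rw [DimOne.realEval_eq]
    have hai : (1 : ℝ) ≤ a i := by exact_mod_cast ha i
    have hbi : (0 : ℝ) ≤ b i := by exact_mod_cast Nat.zero_le _
    push_cast
    nlinarith
  have hsup : S ⊆ Set.Icc (0 : ℝ) N := by
    intro r hr
    exact ⟨hr.1.1 0, hr.1.2 0⟩
  have hfin : volume S ≠ ⊤ :=
    (lt_of_le_of_lt (measure_mono hsup) (by rw [Real.volume_Icc]; exact ENNReal.ofReal_lt_top)).ne
  have h := ENNReal.toReal_mono hfin (measure_mono hsub)
  rwa [Real.volume_Ioc, sub_zero, ENNReal.toReal_ofReal (Nat.cast_nonneg N)] at h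

/-! ### Dickson's conjecture from the crux -/

/-- **The crux gives Dickson's conjecture for injective families, beyond every bound**: for an
injective admissible `(aᵢ n + bᵢ)_{i < t}`, `t ≥ 1`, `aᵢ ≥ 1`, and every `M₀` there is `m > M₀` with all
`aᵢ m + bᵢ` prime — a point of the non-empty cell `{0 ≤ n ≤ N : every aᵢ n + bᵢ a prime > N^{1/u}}`
for `N = max(N₀, N₁, 2, (a₀ M₀ + b₀)^u)`. [cite: GreenTao2010, Conj. 1.4] -/
theorem dickson_injective_of_primeCellsRelative (hP : PrimeCellsRelative) (ht : 1 ≤ t)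
    (a b : Fin t → ℕ) (ha : ∀ i, 1 ≤ a i) (hinj : Function.Injective fun i => (a i, b i))
    (hadm : ∀ p : ℕ, p.Prime → ∃ n : ℕ, ¬p ∣ ∏ i, (a i * n + b i)) (M₀ : ℕ) :
    ∃ m : ℕ, M₀ < m ∧ ∀ i, (a i * m + b i).Prime := by
  set Ψ : Fin t → AffLinForm 1 := fun i => ⟨fun _ => (a i : ℤ), (b i : ℤ)⟩ with hΨ
  have hnd : IsNondegenerateSystem Ψ := isNondegenerateSystem_dickson a b ha hinj hadm
  have hS : 0 < singularProduct Ψ := singularProduct_dickson_pos a b ha hinj hadm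
  set S := singularProduct Ψ with hSdef
  set ε : ℝ := min (1 / 2) (S / 2 ^ (t + 2)) with hε
  have hε0 : 0 < ε := lt_min (by norm_num) (by positivity)
  obtain ⟨u, hu, N₀, hN₀⟩ := hP t (∑ i, (a i + b i)) ht ε hε0
  have hu0 : u ≠ 0 := by omega
  obtain ⟨N₁, hN₁⟩ := eventually_atTop.mp
    (eventually_primeCounting_window (by norm_num : (0 : ℝ) < 1 / 2))
  set i0 : Fin t := ⟨0, ht⟩ with hi0
  set Q : ℕ := a i0 * M₀ + b i0 with hQ
  set N : ℕ := max (max N₀ N₁) (max 2 (Q ^ u)) with hN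
  have hNN₀ : N₀ ≤ N := le_trans (le_max_left _ _) (le_max_left _ _)
  have hNN₁ : N₁ ≤ N := le_trans (le_max_right _ _) (le_max_left _ _)
  have hN2 : 2 ≤ N := le_trans (le_max_left _ _) (le_max_right _ _)
  have hNQ : Q ^ u ≤ N := le_trans (le_max_right _ _) (le_max_right _ _)
  have hN1 : 1 ≤ N := by omega
  set K : Set (Fin 1 → ℝ) := Set.Icc (fun _ : Fin 1 => (0 : ℝ)) (fun _ => (N : ℝ)) with hK
  have hKc : Convex ℝ K := convex_Icc _ _
  have hKB : K ⊆ realBox 1 N := by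
    refine Set.Icc_subset_Icc (fun _ => ?_) le_rfl
    simp only [Left.neg_nonpos_iff, Nat.cast_nonneg]
  have hb := hN₀ N hNN₀ Ψ hnd (affLinSize_dickson_le a b hN1) K hKc hKB
  have hpos := cell_pos_arith t hb (by exact_mod_cast hN2) (le_archFactor_dickson a b ha N) hS
    (one_le_two_mul_log_mul_roughDensity (hN₁ N hNN₁) hN1 hu) (min_le_left _ _)
    (min_le_right _ _)
  clear_value K
  obtain ⟨n, hn⟩ := Finset.card_pos.mp (Nat.cast_pos.mp hpos)
  obtain ⟨-, hnK, hnP⟩ := Finset.mem_filter.mp hn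
  rw [hK] at hnK
  -- `n₀ ≥ 0`
  have hn0 : 0 ≤ n 0 := by
    have := hnK.1 0
    simp only [realPoint] at this
    exact_mod_cast this
  set m : ℕ := (n 0).toNat with hm
  have hmn : (m : ℤ) = n 0 := Int.toNat_of_nonneg hn0
  have hval : ∀ i, ((Ψ i).eval n).toNat = a i * m + b i := by
    intro i
    rw [DimOne.eval_eq, ← hmn]
    exact Int.toNat_natCast _
  refine ⟨m, ?_, fun i => ?_⟩
  · -- `a₀ m + b₀` is a prime `> N^{1/u} ≥ Q = a₀ M₀ + b₀`
    by_contra hle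
    push Not at hle
    have h1 := (hnP i0).1
    rw [hval i0, Nat.Prime.minFac_eq
      (ArithmeticFunction.cardFactors_eq_one_iff_prime.mp (hval i0 ▸ (hnP i0).2))] at h1
    have h2 : a i0 * m + b i0 ≤ Q := by rw [hQ]; gcongr
    have h3 : (Q : ℝ) ≤ (N : ℝ) ^ ((1 : ℝ) / u) := by
      have hQu : ((Q : ℝ) ^ u) ^ ((1 : ℝ) / u) = Q := by
        rw [one_div]; exact Real.pow_rpow_inv_natCast (Nat.cast_nonneg Q) hu0
      rw [← hQu]
      refine Real.rpow_le_rpow (by positivity) ?_ (by positivity)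
      exact_mod_cast hNQ
    have h4 : ((a i0 * m + b i0 : ℕ) : ℝ) ≤ Q := by exact_mod_cast h2
    linarith
  · have h := (hnP i).2
    rw [hval i] at h
    exact ArithmeticFunction.cardFactors_eq_one_iff_prime.mp h

/-- **Hardness certificate: `PrimeCellsRelative → DicksonConjecture`** (parity.S07, registered open
conjecture of the tree). Deduplicate the given family `(aᵢ, bᵢ)_{i < k}` to an injective one
(admissibility and the conclusion only depend on the set of forms) and apply
`dickson_injective_of_primeCellsRelative` beyond every bound. Registered helper of crux
stmt-Parity-14112 (line `Sketch`). [cite: Dickson1904, p. 155] -/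
theorem primeCellsRelative_implies_dicksonConjecture (hP : PrimeCellsRelative) :
    DicksonConjecture := by
  intro k a b ha hadm
  refine Set.infinite_of_forall_exists_gt fun M₀ => ?_
  rcases Nat.eq_zero_or_pos k with hk | hk
  · subst hk
    exact ⟨M₀ + 1, fun i => Fin.elim0 i, Nat.lt_succ_self _⟩
  -- deduplicate the family
  let F : Finset (ℕ × ℕ) := Finset.univ.image fun i => (a i, b i)
  have hFne : F.Nonempty := (Finset.image_nonempty).mpr ⟨⟨0, hk⟩, Finset.mem_univ _⟩
  have ht1 : 1 ≤ F.card := Finset.card_pos.mpr hFne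
  let e : Fin F.card ≃ {x // x ∈ F} := F.equivFin.symm
  let a' : Fin F.card → ℕ := fun j => (e j).1.1
  let b' : Fin F.card → ℕ := fun j => (e j).1.2
  have hmem : ∀ j, ∃ i, a i = a' j ∧ b i = b' j := fun j => by
    obtain ⟨i, -, hi⟩ := Finset.mem_image.mp (e j).2
    exact ⟨i, congrArg Prod.fst hi, congrArg Prod.snd hi⟩
  have hsurj : ∀ i, ∃ j, a' j = a i ∧ b' j = b i := fun i =>
    ⟨e.symm ⟨(a i, b i), Finset.mem_image_of_mem _ (Finset.mem_univ i)⟩,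
      by simp only [a', Equiv.apply_symm_apply], by simp only [b', Equiv.apply_symm_apply]⟩
  have hinj : Function.Injective fun j => (a' j, b' j) := by
    intro j j' h
    apply e.injective
    apply Subtype.ext
    exact Prod.ext (congrArg Prod.fst h) (congrArg Prod.snd h)
  have ha'1 : ∀ j, 1 ≤ a' j := fun j => by
    obtain ⟨i, hi, -⟩ := hmem j
    exact hi ▸ ha i
  have hadm' : ∀ p : ℕ, p.Prime → ∃ n : ℕ, ¬p ∣ ∏ j, (a' j * n + b' j) := fun p hp => by
    obtain ⟨n, hn⟩ := hadm p hp
    refine ⟨n, fun hdvd => hn ?_⟩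
    obtain ⟨j, -, hj⟩ := (Nat.Prime.prime hp).exists_mem_finset_dvd hdvd
    obtain ⟨i, hi1, hi2⟩ := hmem j
    rw [← hi1, ← hi2] at hj
    exact hj.trans (Finset.dvd_prod_of_mem (fun i => a i * n + b i) (Finset.mem_univ i))
  obtain ⟨m, hm, hprime⟩ :=
    dickson_injective_of_primeCellsRelative hP ht1 a' b' ha'1 hinj hadm' M₀
  refine ⟨m, fun i => ?_, hm⟩
  obtain ⟨j, hj1, hj2⟩ := hsurj i
  rw [← hj1, ← hj2]
  exact hprime j

/-! ### Corollaries: the sibling nodes, the summit, and consequences in the tree -/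

/-- `RelativeDimOne` (stmt-Parity-14113) implies Dickson's conjecture, through the landed up-transfer
`primeCellsRelative_of_relativeDimOne`. [cite: GreenTao2010, Conj. 1.4] -/
theorem relativeDimOne_implies_dicksonConjecture (hR : RelativeDimOne) : DicksonConjecture :=
  primeCellsRelative_implies_dicksonConjecture (primeCellsRelative_of_relativeDimOne hR)

/-- `DimOne` (stmt-Parity-0819, Green–Tao Conj. 1.2 at `d = 1`) implies Dickson's conjecture.
[cite: GreenTao2010, Conj. 1.2] -/
theorem dimOne_implies_dicksonConjecture (hD : DimOne) : DicksonConjecture :=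
  primeCellsRelative_implies_dicksonConjecture (primeCellsRelative_of_dimOne hD)

/-- **The summit conjunct implies Dickson's conjecture**: Green–Tao's generalised Hardy–Littlewood
conjecture (all complexities) contains parity.S07. [cite: GreenTao2010, Conj. 1.2] -/
theorem generalizedHardyLittlewood_implies_dicksonConjecture (hG : _root_.GeneralizedHardyLittlewood) :
    DicksonConjecture :=
  primeCellsRelative_implies_dicksonConjecture (primeCellsRelative_of_generalizedHardyLittlewood hG)

/-- The crux gives `DHL[k, k]` for every `k` (every admissible `k`-tuple has infinitely many prime
translates), via `DicksonConjecture.weakDicksonHardyLittlewood`. [cite: Polymath8b2014, Claim 3.1] -/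
theorem primeCellsRelative_implies_weakDHL (hP : PrimeCellsRelative) (k : ℕ) :
    WeakDicksonHardyLittlewood k k :=
  (primeCellsRelative_implies_dicksonConjecture hP).weakDicksonHardyLittlewood k

/-- The crux refutes the second Hardy–Littlewood conjecture `π(x + y) ≤ π(x) + π(y)`
(Hensley–Richards incompatibility, via `DicksonConjecture.not_secondHardyLittlewoodConjecture`).
[cite: HensleyRichards1974, Theorem] -/
theorem primeCellsRelative_not_secondHardyLittlewoodConjecture (hP : PrimeCellsRelative) :
    ¬ Literature.Barriers.Parity.SecondHardyLittlewoodConjecture :=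
  (primeCellsRelative_implies_dicksonConjecture hP).not_secondHardyLittlewoodConjecture

end Summit.Parity.GeneralizedHardyLittlewood.Cruxes.PrimeCellsRelative.Sketch

end
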